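import Mathlib
import HarnessLib
import Summits.HubbardSuperconductivity.HubbardSuperconductivity.Theorems.KLProgrammeKLRegimeEngineTowerLipschitzBridge

/-!
# Route `KLProgramme` — crux K3 ENGINE (stmt-HubbardSuperconductivity-20437 `KLRegimeEngineV17F2`), stub (e) proof-input «(e)-D-ROWS»: THE DIFFERENCE BRIDGE OF THE
# PROFILE-FORM LIPSCHITZ TOWER FROM A RE-MEASUREMENT ROW WITH MARGINAL (OR MILDLY DIVERGENT) JUMP COUNTING AND A GEOMETRIC BUDGET
# (seat hubbard-kl-k3c4-p1 g25, VL lane; companion of `…EngineTowerLipschitzBridge` (p712505); DROWS-SCOPE-g25 §13 (located))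

`…EngineTowerLipschitzBridge.hprofd_of_remeasured` turns the two-volume re-measurement row `dμ k m ≤ Σ_{k′≤k} c₁c₂^m g^{(m−2)(k+1−k′)} db k′ m + sμ k m` into the bridge
hypothesis `hprofd` of `…EngineTowerLipschitzProfileTok.towerBornDiff_le_law_of_profile_tok` when the jump counting CONTRACTS (`g < 1` in every degree `2m ≥ 8`,
`g₃ < 1` at six legs).  The two-volume jump transfer of the tree (`…TwoVolumeLipJumpRows.klJump_transfer_le_of_scaleWtRows`, Schur-type row/column bounds of
`klJump`, no momentum-conservation count) pays one leg more than E1's one-volume count: against the track-`0` unit ratio its coefficient of the born difference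
of an earlier block is `(G·g^m)^{k+1−k′}` with `G·g^m > 1` at six legs (`= 1` at eight legs for the conserved count).  The missing convergence factor is supplied
by the BUDGET: the relative budget `R` of the two-volume tower grows geometrically (the depth gains of block `k` scale like `4^{dk}/L`), so `R k′ ≤ θ^{k−k′}·R k`
for the earlier blocks, and the series `Σ_{k′≤k} (G g^m θ)^{k−k′}` converges as soon as `G·g³·θ < 1`.  This file is p712505 with that bookkeeping:

* `towerMeasured_le_profile_geom` — the core estimate (pure real algebra);
* **`hprofd_of_remeasured_geom`**, **`hprofd3_of_remeasured_geom`** — the two bridge hypotheses of `towerBornDiff_le_law_of_profile_tok` from the row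
  `dμ k m ≤ Σ_{k′∈[0,k]} c₁c₂^m(G g^m)^{k+1−k′} db k′ m + sμ k m` (`db k′ = 0` below block `2`), the geometric budget `R k′ ≤ θ^{k−k′} R k`, `G g³θ < 1`, and sources
  `sμ k m ≤ R k·ΔA·λ^{m−1}(c₂gQ)^m` (resp. `≤ R k·Δ₃λ²`): `A′ := c₁GA/(1 − Gg³θ) + ΔA`, `Q′ := c₂gQ`, `ι₃ := c₁GA(c₂gQ)³/(1 − Gg³θ) + Δ₃`.

Pure real analysis; nothing about the model is asserted; nothing asserts the (D) rows, stub (e), VL, K3 or superconductivity.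
References: BGM 2006 §2.8 (2.93)–(2.98), §3 [cite: BenfattoGiulianiMastropietro2006].
-/

noncomputable section

namespace Summit.HubbardSuperconductivity.HubbardSuperconductivity.Theorems.EngineV8

set_option linter.dupNamespace false -- summit = problem name (single-conjunct summit), D-0017

open Real Finset

/-- **Core estimate.**  If `μ ≤ Σ_{k′≤k} c₁c₂^m(Gg^m)^{k+1−k′}·b k′` with `b k′ ≤ θ^{k−k′}·R k·Aλ^{m−1}Q^m` (`k′ ≤ k`; the born law against a geometric budget),
`0 ≤ R k`, `0 ≤ G`, `0 ≤ g ≤ 1`, `0 ≤ θ`, `Gg³θ < 1` and `3 ≤ m`, then `μ ≤ R k·(c₁GA/(1−Gg³θ))·λ^{m−1}(c₂gQ)^m`. -/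
theorem towerMeasured_le_profile_geom {b : ℕ → ℝ} {R : ℕ → ℝ} {μ A lam Q G g θ c₁ c₂ : ℝ} {k m : ℕ}
    (hA : 0 ≤ A) (hlam : 0 ≤ lam) (hQ : 0 ≤ Q) (hG : 0 ≤ G) (hg0 : 0 ≤ g) (hg1 : g ≤ 1) (hθ : 0 ≤ θ) (hx : G * g ^ 3 * θ < 1)
    (hc₁ : 0 ≤ c₁) (hc₂ : 0 ≤ c₂) (hRk : 0 ≤ R k) (hm : 3 ≤ m)
    (hμ : μ ≤ ∑ k' ∈ range (k + 1), c₁ * c₂ ^ m * (G * g ^ m) ^ (k + 1 - k') * b k')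
    (hborn : ∀ k' ≤ k, b k' ≤ θ ^ (k - k') * R k * (A * lam ^ (m - 1) * Q ^ m)) :
    μ ≤ R k * ((c₁ * G * A / (1 - G * g ^ 3 * θ)) * lam ^ (m - 1) * (c₂ * g * Q) ^ m) := by
  set x : ℝ := G * g ^ 3 * θ with hxdef
  have hx0 : 0 ≤ x := by positivity
  have hx1 : 0 < 1 - x := sub_pos.2 hx
  have hgm : g ^ m ≤ g ^ 3 := pow_le_pow_of_le_one hg0 hg1 hm
  have hGgθ : G * g ^ m * θ ≤ x := by rw [hxdef]; gcongr
  have hGgθ0 : 0 ≤ G * g ^ m * θ := by positivity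
  refine hμ.trans ?_
  have hterm : ∀ k' ∈ range (k + 1), c₁ * c₂ ^ m * (G * g ^ m) ^ (k + 1 - k') * b k' ≤
      (c₁ * c₂ ^ m * (G * g ^ m) * (R k * (A * lam ^ (m - 1) * Q ^ m))) * x ^ (k - k') := by
    intro k' hk'
    have hk'le : k' ≤ k := Nat.lt_succ_iff.1 (mem_range.1 hk')
    have hsplit : (G * g ^ m) ^ (k + 1 - k') = (G * g ^ m) * (G * g ^ m) ^ (k - k') := by
      rw [show k + 1 - k' = (k - k') + 1 by omega, pow_succ]; ring
    have hbk : b k' ≤ θ ^ (k - k') * R k * (A * lam ^ (m - 1) * Q ^ m) := hborn k' hk'le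
    have hpow : (G * g ^ m) ^ (k - k') * θ ^ (k - k') ≤ x ^ (k - k') := by
      rw [← mul_pow]; exact pow_le_pow_left₀ hGgθ0 hGgθ _
    calc c₁ * c₂ ^ m * (G * g ^ m) ^ (k + 1 - k') * b k'
        ≤ c₁ * c₂ ^ m * (G * g ^ m) ^ (k + 1 - k') * (θ ^ (k - k') * R k * (A * lam ^ (m - 1) * Q ^ m)) :=
          mul_le_mul_of_nonneg_left hbk (by positivity)
      _ = (c₁ * c₂ ^ m * (G * g ^ m) * (R k * (A * lam ^ (m - 1) * Q ^ m))) * ((G * g ^ m) ^ (k - k') * θ ^ (k - k')) := by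
          rw [hsplit]; ring
      _ ≤ (c₁ * c₂ ^ m * (G * g ^ m) * (R k * (A * lam ^ (m - 1) * Q ^ m))) * x ^ (k - k') :=
          mul_le_mul_of_nonneg_left hpow (by positivity)
  refine (sum_le_sum hterm).trans ?_
  rw [← mul_sum]
  have hgeom : ∑ k' ∈ range (k + 1), x ^ (k - k') ≤ 1 / (1 - x) := by
    have hrefl := sum_range_reflect (fun t => x ^ t) (k + 1)
    have : ∑ k' ∈ range (k + 1), x ^ (k - k') = ∑ t ∈ range (k + 1), x ^ t := by
      rw [← hrefl]
      refine sum_congr rfl fun j hj => ?_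
      simp only [Nat.add_sub_cancel]
    rw [this]
    have h := geom_sum_Ico_le_of_lt_one hx0 hx (m := 0) (n := k + 1)
    rwa [pow_zero, ← range_eq_Ico] at h
  have hcoef : 0 ≤ c₁ * c₂ ^ m * (G * g ^ m) * (R k * (A * lam ^ (m - 1) * Q ^ m)) := by positivity
  calc c₁ * c₂ ^ m * (G * g ^ m) * (R k * (A * lam ^ (m - 1) * Q ^ m)) * ∑ k' ∈ range (k + 1), x ^ (k - k')
      ≤ c₁ * c₂ ^ m * (G * g ^ m) * (R k * (A * lam ^ (m - 1) * Q ^ m)) * (1 / (1 - x)) := mul_le_mul_of_nonneg_left hgeom hcoef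
    _ = R k * ((c₁ * G * A / (1 - x)) * lam ^ (m - 1) * (c₂ * g * Q) ^ m) := by
        rw [mul_pow, mul_pow]
        field_simp

/-- **The difference bridge in degrees `2m ≥ 8` from the re-measurement row with marginal jump counting and a geometric budget.**  Constants `A, λ, Q ≥ 0`,
`G ≥ 0`, `0 ≤ g ≤ 1`, `θ ≥ 0` with `Gg³θ < 1`, `c₁, c₂ ≥ 0`, any `ΔA`; born differences `db` vanishing below block `2` (no sign needed); budget `0 ≤ R 1`, `R k + s k ≤ R (k+1)`,
`0 ≤ s`, GEOMETRIC `R k′ ≤ θ^{k−k′} R k` (`k′ ≤ k`); the row `dμ k m ≤ Σ_{k′≤k} c₁c₂^m(Gg^m)^{k+1−k′} db k′ m + sμ k m` with `sμ k m ≤ R k·ΔA·λ^{m−1}(c₂gQ)^m`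
(`3 ≤ m ≤ D`, `1 ≤ k < K`).  Then the `hprofd` hypothesis of `towerBornDiff_le_law_of_profile_tok` holds with `A′ = c₁GA/(1−Gg³θ) + ΔA`, `Q′ = c₂gQ`. -/
theorem hprofd_of_remeasured_geom {D K : ℕ} {db dμ sμ : ℕ → ℕ → ℝ} {R s : ℕ → ℝ} {A lam Q G g θ c₁ c₂ ΔA : ℝ}
    (hA : 0 ≤ A) (hlam : 0 ≤ lam) (hQ : 0 ≤ Q) (hG : 0 ≤ G) (hg0 : 0 ≤ g) (hg1 : g ≤ 1) (hθ : 0 ≤ θ) (hx : G * g ^ 3 * θ < 1)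
    (hc₁ : 0 ≤ c₁) (hc₂ : 0 ≤ c₂)
    (hdblow : ∀ k', k' < 2 → ∀ m, db k' m = 0)
    (hs0 : ∀ k, 0 ≤ s k) (hR1 : 0 ≤ R 1) (hR : ∀ k, R k + s k ≤ R (k + 1))
    (hRθ : ∀ k' k, 1 ≤ k' → k' ≤ k → R k' ≤ θ ^ (k - k') * R k)
    (hrow : ∀ k, 1 ≤ k → k < K → ∀ m, 3 ≤ m → m ≤ D →
      dμ k m ≤ (∑ k' ∈ range (k + 1), c₁ * c₂ ^ m * (G * g ^ m) ^ (k + 1 - k') * db k' m) + sμ k m)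
    (hsμ : ∀ k, 1 ≤ k → k < K → ∀ m, 3 ≤ m → m ≤ D → sμ k m ≤ R k * (ΔA * lam ^ (m - 1) * (c₂ * g * Q) ^ m)) :
    ∀ k, 1 ≤ k → k < K →
      (∀ k', 2 ≤ k' → k' ≤ k → ∀ p, 3 ≤ p → p ≤ D → db k' p ≤ R k' * (A * lam ^ (p - 1) * Q ^ p)) →
      ∀ m, 4 ≤ m → m ≤ D → dμ k m ≤ R k * ((c₁ * G * A / (1 - G * g ^ 3 * θ) + ΔA) * lam ^ (m - 1) * (c₂ * g * Q) ^ m) := by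
  intro k hk1 hkK hlaw m hm hmD
  have hRmono : ∀ {k' k''}, k' ≤ k'' → R k' ≤ R k'' := fun h => budget_mono hs0 hR h
  have hRk : 0 ≤ R k := hR1.trans (hRmono hk1)
  -- the born differences of the blocks `≤ k` against the geometric budget (zero below block `2`)
  have hborn : ∀ k' ≤ k, db k' m ≤ θ ^ (k - k') * R k * (A * lam ^ (m - 1) * Q ^ m) := by
    intro k' hk'
    rcases Nat.lt_or_ge k' 2 with hlt | hge
    · rw [hdblow k' hlt m]; positivity
    · exact (hlaw k' hge hk' m (by omega) hmD).trans
        (mul_le_mul_of_nonneg_right (hRθ k' k (by omega) hk') (by positivity))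
  have hT1 := towerMeasured_le_profile_geom (b := fun k' => db k' m) hA hlam hQ hG hg0 hg1 hθ hx hc₁ hc₂ hRk (by omega : 3 ≤ m) le_rfl hborn
  have hsrc := hsμ k hk1 hkK m (by omega) hmD
  calc dμ k m ≤ (∑ k' ∈ range (k + 1), c₁ * c₂ ^ m * (G * g ^ m) ^ (k + 1 - k') * db k' m) + sμ k m := hrow k hk1 hkK m (by omega) hmD
    _ ≤ R k * ((c₁ * G * A / (1 - G * g ^ 3 * θ)) * lam ^ (m - 1) * (c₂ * g * Q) ^ m) + R k * (ΔA * lam ^ (m - 1) * (c₂ * g * Q) ^ m) :=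
        add_le_add hT1 hsrc
    _ = R k * ((c₁ * G * A / (1 - G * g ^ 3 * θ) + ΔA) * lam ^ (m - 1) * (c₂ * g * Q) ^ m) := by ring

/-- **The difference bridge at six legs from the re-measurement row with marginal jump counting and a geometric budget**: the `hprofd3` hypothesis of
`towerBornDiff_le_law_of_profile_tok` with `ι₃ := c₁GA(c₂gQ)³/(1−Gg³θ) + Δ₃`, from the degree-`6` row and sources `sμ k 3 ≤ R k·Δ₃λ²`. -/
theorem hprofd3_of_remeasured_geom {D K : ℕ} {db dμ sμ : ℕ → ℕ → ℝ} {R s : ℕ → ℝ} {A lam Q G g θ c₁ c₂ Δ₃ : ℝ}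
    (hA : 0 ≤ A) (hlam : 0 ≤ lam) (hQ : 0 ≤ Q) (hG : 0 ≤ G) (hg0 : 0 ≤ g) (hg1 : g ≤ 1) (hθ : 0 ≤ θ) (hx : G * g ^ 3 * θ < 1)
    (hc₁ : 0 ≤ c₁) (hc₂ : 0 ≤ c₂)
    (hdblow : ∀ k', k' < 2 → ∀ m, db k' m = 0)
    (hs0 : ∀ k, 0 ≤ s k) (hR1 : 0 ≤ R 1) (hR : ∀ k, R k + s k ≤ R (k + 1))
    (hRθ : ∀ k' k, 1 ≤ k' → k' ≤ k → R k' ≤ θ ^ (k - k') * R k)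
    (hrow : ∀ k, 1 ≤ k → k < K → dμ k 3 ≤ (∑ k' ∈ range (k + 1), c₁ * c₂ ^ 3 * (G * g ^ 3) ^ (k + 1 - k') * db k' 3) + sμ k 3)
    (hsμ : ∀ k, 1 ≤ k → k < K → sμ k 3 ≤ R k * (Δ₃ * lam ^ 2)) :
    ∀ k, 1 ≤ k → k < K → 3 ≤ D →
      (∀ k', 2 ≤ k' → k' ≤ k → ∀ p, 3 ≤ p → p ≤ D → db k' p ≤ R k' * (A * lam ^ (p - 1) * Q ^ p)) →
      dμ k 3 ≤ R k * ((c₁ * G * A / (1 - G * g ^ 3 * θ) * (c₂ * g * Q) ^ 3 + Δ₃) * lam ^ 2) := by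
  intro k hk1 hkK hD3 hlaw
  have hRmono : ∀ {k' k''}, k' ≤ k'' → R k' ≤ R k'' := fun h => budget_mono hs0 hR h
  have hRk : 0 ≤ R k := hR1.trans (hRmono hk1)
  have hborn : ∀ k' ≤ k, db k' 3 ≤ θ ^ (k - k') * R k * (A * lam ^ (3 - 1) * Q ^ 3) := by
    intro k' hk'
    rcases Nat.lt_or_ge k' 2 with hlt | hge
    · rw [hdblow k' hlt 3]; positivity
    · exact (hlaw k' hge hk' 3 le_rfl hD3).trans
        (mul_le_mul_of_nonneg_right (hRθ k' k (by omega) hk') (by positivity))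
  have hT1 := towerMeasured_le_profile_geom (b := fun k' => db k' 3) hA hlam hQ hG hg0 hg1 hθ hx hc₁ hc₂ hRk le_rfl le_rfl hborn
  have hsrc := hsμ k hk1 hkK
  calc dμ k 3 ≤ (∑ k' ∈ range (k + 1), c₁ * c₂ ^ 3 * (G * g ^ 3) ^ (k + 1 - k') * db k' 3) + sμ k 3 := hrow k hk1 hkK
    _ ≤ R k * ((c₁ * G * A / (1 - G * g ^ 3 * θ)) * lam ^ (3 - 1) * (c₂ * g * Q) ^ 3) + R k * (Δ₃ * lam ^ 2) := add_le_add hT1 hsrc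
    _ = R k * ((c₁ * G * A / (1 - G * g ^ 3 * θ) * (c₂ * g * Q) ^ 3 + Δ₃) * lam ^ 2) := by norm_num; ring

end Summit.HubbardSuperconductivity.HubbardSuperconductivity.Theorems.EngineV8

end
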